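import Summits.CriticalPhenomena.PercolationContinuityZ3.Theorems.PercNearOneGluingAdditiveGluingSharpTransferRate
import HarnessLib

/-!
# Crux `PercNearOneGluing.AdditiveGluing` (stmt-CriticalPhenomena-4576), line `tieline`: (T♯) ⟹ (T) unconditionally

Support file (`--supports stmt-CriticalPhenomena-4576`, helper, seat (d) exchange-certificate form, gen 9).  No definitions,
no named facts, no sorries.

`SharpTransfer.covTransferQ_of_sharp` (file `…SharpTransferRate`) derives the registered kernel (T) = `stub_k0CovTransferQ_c9` at
roles `(o,b,u,v,c)` from the sharp form (T♯) when `c ≠ u`, `c ≠ v`, `u ≠ v` and `μ(Z) > 0`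
(`Z = {c↮u} ∩ {c↮v} ∩ {u↮v} ∩ {u↮b} ∩ {v↮b}`).  This file removes the side conditions: if `μ(Z) = 0` then the
positive-weight configuration `ω₁ = {e | w e = 1}` (all sure edges open, everything else closed) lies outside `Z`, so one of the
five connections holds in `ω₁` and hence almost surely (every positive-weight configuration contains `ω₁`); in each of the five
cases both sides of (T) coincide or vanish (`covTransferQ_of_real_Z_eq_zero`).  Consequently
`covTransferQ_of_sharpAll : (∀ roles, T♯) → (∀ roles, T)` — the sharp form is an honest replacement for the registered stub
(its statement is the `∀ n w o b u v c` body of `stub_k0CovTransferQ_c9`, verbatim up to namespaces).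
[cite: VandenbergHaggstromKahn2005, Thm. 1.3 (p. 6), Thm. 1.5 (p. 7) — corollary]
-/

namespace Summit.CriticalPhenomena.PercolationContinuityZ3.Cruxes.AdditiveGluing.TieLine

open MeasureTheory Set
open Literature.Probability.LatticeModels (prodBernoulli)
open Literature.Probability.Percolation
open Literature.Probability.Percolation.BHK2006
open Literature.Probability.Percolation.DecisionTree (ind ind_of_mem ind_of_not_mem ind_nonneg)

noncomputable section
open scoped Classical

namespace SharpTransfer

open UncenteredTransfer

variable {V : Type*} [Fintype V] (w : Sym2 V → unitInterval)

/-- The sure configuration `ω₁ = {e | w e = 1}` has positive weight. [folklore] -/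
theorem weight_sure_pos : 0 < weight (fun e => (w e : ℝ)) {e : Sym2 V | (w e : ℝ) = 1} := by
  unfold weight
  refine Finset.prod_pos fun e _ => ?_
  by_cases he : (w e : ℝ) = 1
  · rw [if_pos (show e ∈ {e : Sym2 V | (w e : ℝ) = 1} from he)]
    show (0 : ℝ) < (w e : ℝ)
    rw [he]; norm_num
  · rw [if_neg (show e ∉ {e : Sym2 V | (w e : ℝ) = 1} from he)]
    show (0 : ℝ) < 1 - (w e : ℝ)
    have h1 : (w e : ℝ) ≤ 1 := (w e).2.2
    have : (w e : ℝ) < 1 := lt_of_le_of_ne h1 he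
    linarith

omit [Fintype V] in
/-- A configuration not containing a sure edge has weight zero. [folklore] -/
theorem weight_eq_zero_of_not_sure [Fintype V] {ω : Set (Sym2 V)} {e : Sym2 V} (he : (w e : ℝ) = 1) (heω : e ∉ ω) :
    weight (fun e => (w e : ℝ)) ω = 0 := by
  unfold weight
  refine Finset.prod_eq_zero (Finset.mem_univ e) ?_
  rw [if_neg heω]
  show 1 - (w e : ℝ) = 0
  rw [he]; norm_num

/-- If `x ↔ y` already in the sure configuration, then `{x ↮ y}` is null: `μ(A ∩ {x↔y}ᶜ) = 0`. [folklore] -/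
theorem real_inter_compl_eq_zero_of_sure {x y : V} (hxy : (openGraph {e : Sym2 V | (w e : ℝ) = 1}).Reachable x y)
    (A : Set (BondConfig V)) : (prodBernoulli w).real (A ∩ (openConn x y)ᶜ) = 0 := by
  rw [real_eq_sum]
  refine Finset.sum_eq_zero fun ω _ => ?_
  by_cases hω : ω ∈ A ∩ (openConn x y)ᶜ
  · -- some sure edge is missing from `ω`
    have hnot : ¬ {e : Sym2 V | (w e : ℝ) = 1} ⊆ ω := fun hsub => hω.2 (reach_mono hsub hxy)
    rcases Set.not_subset.1 hnot with ⟨e, he, heω⟩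
    rw [weight_eq_zero_of_not_sure w he heω, zero_mul]
  · rw [ind_of_not_mem hω, mul_zero]

/-- If `x ↔ y` in the sure configuration, intersecting with `{x ↔ y}` does not change the measure. [folklore] -/
theorem real_inter_eq_of_sure {x y : V} (hxy : (openGraph {e : Sym2 V | (w e : ℝ) = 1}).Reachable x y)
    (A : Set (BondConfig V)) : (prodBernoulli w).real (A ∩ openConn x y) = (prodBernoulli w).real A := by
  have h := measureReal_inter_add_sdiff (μ := prodBernoulli w) (s := A) (t := (openConn x y : Set (BondConfig V)))
    MeasurableSet.of_discrete
  rw [Set.sdiff_eq, real_inter_compl_eq_zero_of_sure w hxy A, add_zero] at h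
  exact h

/-- **The degenerate case.**  If `μ(Z) = 0` then (T) holds (both sides agree or vanish). [folklore] -/
theorem covTransferQ_of_real_Z_eq_zero (u v o c b : V)
    (hZ : (prodBernoulli w).real ((openConn c u)ᶜ ∩ (openConn c v)ᶜ ∩ (openConn u v)ᶜ ∩ (openConn u b)ᶜ ∩
      (openConn v b)ᶜ) = 0) :
    (prodBernoulli w).real ((openConn u v)ᶜ : Set (BondConfig V)) *
        ((prodBernoulli w).real ((openConn u v)ᶜ ∩ openConn u b ∩ openConn v o) *
            (prodBernoulli w).real ((openConn c u)ᶜ ∩ (openConn c v)ᶜ : Set (BondConfig V)) -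
          (prodBernoulli w).real ((openConn u v)ᶜ ∩ openConn u b ∩ openConn v c) *
            (prodBernoulli w).real ((openConn c u)ᶜ ∩ (openConn c v)ᶜ ∩ openConn o c)) ≤
      (prodBernoulli w).real ((openConn u v)ᶜ ∩ openConn u b) *
        ((prodBernoulli w).real ((openConn u v)ᶜ ∩ openConn v o) *
            (prodBernoulli w).real ((openConn c u)ᶜ ∩ (openConn c v)ᶜ : Set (BondConfig V)) -
          (prodBernoulli w).real ((openConn u v)ᶜ ∩ openConn v c) *
            (prodBernoulli w).real ((openConn c u)ᶜ ∩ (openConn c v)ᶜ ∩ openConn o c)) := by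
  set ω₁ : Set (Sym2 V) := {e : Sym2 V | (w e : ℝ) = 1} with hω₁
  -- `ω₁ ∉ Z`
  have hsum : ∑ ω : Set (Sym2 V), weight (fun e => (w e : ℝ)) ω *
      ind ((openConn c u)ᶜ ∩ (openConn c v)ᶜ ∩ (openConn u v)ᶜ ∩ (openConn u b)ᶜ ∩ (openConn v b)ᶜ : Set (BondConfig V)) ω = 0 := by
    rw [← real_eq_sum]; exact hZ
  have hterm := (Finset.sum_eq_zero_iff_of_nonneg fun ω _ =>
    mul_nonneg (weight_nonneg (wr_nonneg w) (wr_le_one w) ω) (ind_nonneg _ _)).1 hsum ω₁ (Finset.mem_univ _)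
  have hnotZ : ω₁ ∉ ((openConn c u)ᶜ ∩ (openConn c v)ᶜ ∩ (openConn u v)ᶜ ∩ (openConn u b)ᶜ ∩ (openConn v b)ᶜ :
      Set (BondConfig V)) := by
    intro hmem
    rw [ind_of_mem hmem, mul_one] at hterm
    exact (weight_sure_pos w).ne' hterm
  simp only [Set.mem_inter_iff, Set.mem_compl_iff, not_and_or, not_not] at hnotZ
  -- abbreviations
  have sub0 : ∀ A B : Set (BondConfig V), (prodBernoulli w).real A = 0 → (prodBernoulli w).real (A ∩ B) = 0 :=
    fun A B h => le_antisymm ((measureReal_mono Set.inter_subset_left).trans h.le) measureReal_nonneg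
  rcases hnotZ with (((hcu | hcv) | huv) | hub) | hvb
  · -- `c ↔ u` surely: `μ(N) = μ(N ∩ oc) = 0`
    have hN : (prodBernoulli w).real ((openConn c u)ᶜ ∩ (openConn c v)ᶜ : Set (BondConfig V)) = 0 := by
      rw [Set.inter_comm]; exact real_inter_compl_eq_zero_of_sure w hcu _
    rw [sub0 _ _ hN, hN]; simp
  · -- `c ↔ v` surely
    have hN : (prodBernoulli w).real ((openConn c u)ᶜ ∩ (openConn c v)ᶜ : Set (BondConfig V)) = 0 :=
      real_inter_compl_eq_zero_of_sure w hcv _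
    rw [sub0 _ _ hN, hN]; simp
  · -- `u ↔ v` surely: every `D`-term vanishes
    have hD : (prodBernoulli w).real ((openConn u v)ᶜ : Set (BondConfig V)) = 0 := by
      have := real_inter_compl_eq_zero_of_sure w huv Set.univ
      rwa [Set.univ_inter] at this
    have hDub : (prodBernoulli w).real ((openConn u v)ᶜ ∩ openConn u b : Set (BondConfig V)) = 0 := sub0 _ _ hD
    rw [hD, hDub]; simp
  · -- `u ↔ b` surely: intersecting with `{u↔b}` is free
    rw [real_inter_eq_of_sure w hub, Set.inter_right_comm ((openConn u v)ᶜ) (openConn u b) (openConn v o),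
      real_inter_eq_of_sure w hub, Set.inter_right_comm ((openConn u v)ᶜ) (openConn u b) (openConn v c),
      real_inter_eq_of_sure w hub]
  · -- `v ↔ b` surely: then `{u↮v} ∩ {u↔b}` is null
    have hDub : (prodBernoulli w).real ((openConn u v)ᶜ ∩ openConn u b : Set (BondConfig V)) = 0 := by
      rw [← real_inter_eq_of_sure w hvb ((openConn u v)ᶜ ∩ openConn u b)]
      have : ((openConn u v)ᶜ ∩ openConn u b ∩ openConn v b : Set (BondConfig V)) = ∅ := by
        ext ω
        constructor
        · rintro ⟨⟨huv', hub'⟩, hvb'⟩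
          exact huv' (show (openGraph ω).Reachable u v from
            (show (openGraph ω).Reachable u b from hub').trans (show (openGraph ω).Reachable v b from hvb').symm)
        · intro h; exact h.elim
      rw [this, measureReal_empty]
    rw [sub0 _ _ hDub, sub0 _ _ hDub, hDub]; simp

/-- **(T♯) ⟹ (T) at fixed roles, no side conditions.** [cite: VandenbergHaggstromKahn2005, Thm. 1.3 (p. 6), Thm. 1.5 (p. 7) — corollary] -/
theorem covTransferQ_of_sharp' (u v o c b : V)
    (hsharp : (prodBernoulli w).real ((openConn u v)ᶜ : Set (BondConfig V)) *
        ((prodBernoulli w).real ((openConn u v)ᶜ ∩ openConn u b ∩ openConn v o) *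
            (prodBernoulli w).real ((openConn c u)ᶜ ∩ (openConn c v)ᶜ ∩ (openConn u v)ᶜ ∩ (openConn u b)ᶜ ∩ (openConn v b)ᶜ) -
          (prodBernoulli w).real ((openConn u v)ᶜ ∩ openConn u b ∩ openConn v c) *
            (prodBernoulli w).real ((openConn c u)ᶜ ∩ (openConn c v)ᶜ ∩ (openConn u v)ᶜ ∩ (openConn u b)ᶜ ∩ (openConn v b)ᶜ ∩
              openConn o c)) ≤
      (prodBernoulli w).real ((openConn u v)ᶜ ∩ openConn u b) *
        ((prodBernoulli w).real ((openConn u v)ᶜ ∩ openConn v o) *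
            (prodBernoulli w).real ((openConn c u)ᶜ ∩ (openConn c v)ᶜ ∩ (openConn u v)ᶜ ∩ (openConn u b)ᶜ ∩ (openConn v b)ᶜ) -
          (prodBernoulli w).real ((openConn u v)ᶜ ∩ openConn v c) *
            (prodBernoulli w).real ((openConn c u)ᶜ ∩ (openConn c v)ᶜ ∩ (openConn u v)ᶜ ∩ (openConn u b)ᶜ ∩ (openConn v b)ᶜ ∩
              openConn o c))) :
    (prodBernoulli w).real ((openConn u v)ᶜ : Set (BondConfig V)) *
        ((prodBernoulli w).real ((openConn u v)ᶜ ∩ openConn u b ∩ openConn v o) *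
            (prodBernoulli w).real ((openConn c u)ᶜ ∩ (openConn c v)ᶜ : Set (BondConfig V)) -
          (prodBernoulli w).real ((openConn u v)ᶜ ∩ openConn u b ∩ openConn v c) *
            (prodBernoulli w).real ((openConn c u)ᶜ ∩ (openConn c v)ᶜ ∩ openConn o c)) ≤
      (prodBernoulli w).real ((openConn u v)ᶜ ∩ openConn u b) *
        ((prodBernoulli w).real ((openConn u v)ᶜ ∩ openConn v o) *
            (prodBernoulli w).real ((openConn c u)ᶜ ∩ (openConn c v)ᶜ : Set (BondConfig V)) -
          (prodBernoulli w).real ((openConn u v)ᶜ ∩ openConn v c) *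
            (prodBernoulli w).real ((openConn c u)ᶜ ∩ (openConn c v)ᶜ ∩ openConn o c)) := by
  by_cases hZ : (prodBernoulli w).real ((openConn c u)ᶜ ∩ (openConn c v)ᶜ ∩ (openConn u v)ᶜ ∩ (openConn u b)ᶜ ∩
      (openConn v b)ᶜ) = 0
  · exact covTransferQ_of_real_Z_eq_zero w u v o c b hZ
  have hZpos : 0 < (prodBernoulli w).real ((openConn c u)ᶜ ∩ (openConn c v)ᶜ ∩ (openConn u v)ᶜ ∩ (openConn u b)ᶜ ∩
      (openConn v b)ᶜ) := lt_of_le_of_ne measureReal_nonneg (Ne.symm hZ)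
  -- when `μ(Z) > 0` the vertices `c,u`, `c,v`, `u,v` are distinct (else `Z = ∅`)
  have hne : ∀ x y : V, x = y → (prodBernoulli w).real ((openConn x y)ᶜ : Set (BondConfig V)) = 0 := by
    rintro x y rfl
    have : ((openConn x x)ᶜ : Set (BondConfig V)) = ∅ := by
      ext ω; simp only [Set.mem_compl_iff, Set.mem_empty_iff_false, iff_false, not_not]
      exact (SimpleGraph.Reachable.refl x : (openGraph ω).Reachable x x)
    rw [this, measureReal_empty]
  have sub0 : ∀ A B : Set (BondConfig V), (prodBernoulli w).real A = 0 → (prodBernoulli w).real (A ∩ B) = 0 :=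
    fun A B h => le_antisymm ((measureReal_mono Set.inter_subset_left).trans h.le) measureReal_nonneg
  have sub0' : ∀ A B : Set (BondConfig V), (prodBernoulli w).real B = 0 → (prodBernoulli w).real (A ∩ B) = 0 :=
    fun A B h => le_antisymm ((measureReal_mono Set.inter_subset_right).trans h.le) measureReal_nonneg
  have hcu : c ≠ u := by
    intro h; apply hZ
    exact sub0 _ _ (sub0 _ _ (sub0 _ _ (sub0 _ _ (hne c u h))))
  have hcv : c ≠ v := by
    intro h; apply hZ
    exact sub0 _ _ (sub0 _ _ (sub0 _ _ (sub0' _ _ (hne c v h))))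
  have huv : u ≠ v := by
    intro h; apply hZ
    exact sub0 _ _ (sub0 _ _ (sub0' _ _ (hne u v h)))
  exact covTransferQ_of_sharp w u v o c b hcu hcv huv hZpos hsharp

/-- **The sharp form is an honest replacement for the registered stub**: if (T♯) holds at all roles on all finite weighted graphs,
then so does (T) = `stub_k0CovTransferQ_c9` (statement verbatim). [cite: VandenbergHaggstromKahn2005, Thm. 1.3 (p. 6), Thm. 1.5 (p. 7) — corollary] -/
theorem covTransferQ_of_sharpAll
    (hsharp : ∀ (n : ℕ) (w : Sym2 (Fin n) → unitInterval) (o b u v c : Fin n),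
      (prodBernoulli w).real ((openConn u v)ᶜ : Set (BondConfig (Fin n))) *
        ((prodBernoulli w).real ((openConn u v)ᶜ ∩ openConn u b ∩ openConn v o : Set (BondConfig (Fin n))) *
            (prodBernoulli w).real ((openConn c u)ᶜ ∩ (openConn c v)ᶜ ∩ (openConn u v)ᶜ ∩ (openConn u b)ᶜ ∩ (openConn v b)ᶜ :
              Set (BondConfig (Fin n))) -
          (prodBernoulli w).real ((openConn u v)ᶜ ∩ openConn u b ∩ openConn v c : Set (BondConfig (Fin n))) *
            (prodBernoulli w).real ((openConn c u)ᶜ ∩ (openConn c v)ᶜ ∩ (openConn u v)ᶜ ∩ (openConn u b)ᶜ ∩ (openConn v b)ᶜ ∩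
              openConn o c : Set (BondConfig (Fin n)))) ≤
      (prodBernoulli w).real ((openConn u v)ᶜ ∩ openConn u b : Set (BondConfig (Fin n))) *
        ((prodBernoulli w).real ((openConn u v)ᶜ ∩ openConn v o : Set (BondConfig (Fin n))) *
            (prodBernoulli w).real ((openConn c u)ᶜ ∩ (openConn c v)ᶜ ∩ (openConn u v)ᶜ ∩ (openConn u b)ᶜ ∩ (openConn v b)ᶜ :
              Set (BondConfig (Fin n))) -
          (prodBernoulli w).real ((openConn u v)ᶜ ∩ openConn v c : Set (BondConfig (Fin n))) *
            (prodBernoulli w).real ((openConn c u)ᶜ ∩ (openConn c v)ᶜ ∩ (openConn u v)ᶜ ∩ (openConn u b)ᶜ ∩ (openConn v b)ᶜ ∩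
              openConn o c : Set (BondConfig (Fin n))))) :
    ∀ (n : ℕ) (w : Sym2 (Fin n) → unitInterval) (o b u v c : Fin n),
      (Literature.Probability.LatticeModels.prodBernoulli w).real
          ((Literature.Probability.Percolation.openConn u v)ᶜ : Set (Literature.Probability.Percolation.BondConfig (Fin n))) *
        ((Literature.Probability.LatticeModels.prodBernoulli w).real
            ((Literature.Probability.Percolation.openConn u v)ᶜ ∩ Literature.Probability.Percolation.openConn u b ∩
              Literature.Probability.Percolation.openConn v o : Set (Literature.Probability.Percolation.BondConfig (Fin n))) *
          (Literature.Probability.LatticeModels.prodBernoulli w).real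
            ((Literature.Probability.Percolation.openConn c u)ᶜ ∩ (Literature.Probability.Percolation.openConn c v)ᶜ :
              Set (Literature.Probability.Percolation.BondConfig (Fin n))) -
          (Literature.Probability.LatticeModels.prodBernoulli w).real
            ((Literature.Probability.Percolation.openConn u v)ᶜ ∩ Literature.Probability.Percolation.openConn u b ∩
              Literature.Probability.Percolation.openConn v c : Set (Literature.Probability.Percolation.BondConfig (Fin n))) *
          (Literature.Probability.LatticeModels.prodBernoulli w).real
            ((Literature.Probability.Percolation.openConn c u)ᶜ ∩ (Literature.Probability.Percolation.openConn c v)ᶜ ∩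
              Literature.Probability.Percolation.openConn o c : Set (Literature.Probability.Percolation.BondConfig (Fin n)))) ≤
      (Literature.Probability.LatticeModels.prodBernoulli w).real
          ((Literature.Probability.Percolation.openConn u v)ᶜ ∩ Literature.Probability.Percolation.openConn u b :
            Set (Literature.Probability.Percolation.BondConfig (Fin n))) *
        ((Literature.Probability.LatticeModels.prodBernoulli w).real
            ((Literature.Probability.Percolation.openConn u v)ᶜ ∩ Literature.Probability.Percolation.openConn v o :
              Set (Literature.Probability.Percolation.BondConfig (Fin n))) *
          (Literature.Probability.LatticeModels.prodBernoulli w).real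
            ((Literature.Probability.Percolation.openConn c u)ᶜ ∩ (Literature.Probability.Percolation.openConn c v)ᶜ :
              Set (Literature.Probability.Percolation.BondConfig (Fin n))) -
          (Literature.Probability.LatticeModels.prodBernoulli w).real
            ((Literature.Probability.Percolation.openConn u v)ᶜ ∩ Literature.Probability.Percolation.openConn v c :
              Set (Literature.Probability.Percolation.BondConfig (Fin n))) *
          (Literature.Probability.LatticeModels.prodBernoulli w).real
            ((Literature.Probability.Percolation.openConn c u)ᶜ ∩ (Literature.Probability.Percolation.openConn c v)ᶜ ∩
              Literature.Probability.Percolation.openConn o c : Set (Literature.Probability.Percolation.BondConfig (Fin n)))) :=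
  fun n w o b u v c => covTransferQ_of_sharp' w u v o c b (hsharp n w o b u v c)

end SharpTransfer

end

end Summit.CriticalPhenomena.PercolationContinuityZ3.Cruxes.AdditiveGluing.TieLine
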